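import Mathlib
import Literature.Analysis.FluidPDE.TypeIAncientMild
import Literature.Analysis.FluidPDE.OseenSlice
import HarnessLib

/-!
# Route SymmetryModuliCount — crux `HelicalEndLiouville` (stmt-NavierStokesRegularity-14062),
# line `vanishing-cell-reynolds`, stub 4: the mean cannot force the oscillation

Write `Π₀ h (x) = ∫₀¹ h (x + rL) dr` for the cell mean along a period vector `L` and
`N_σ[a, b] = e^{σΔ} P ∇·(a ⊗ b)` for the Oseen slice operator (`oseenSlice`). Given the Oseen
cell gap with some constant `κ` — the cell oscillation `(I − Π₀) N_σ[f, g]` of one slice of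
`L`-periodic bounded continuous fields is `≤ κ · min(σ^{-1/2}, ‖L‖² σ^{-3/2}) · M_f M_g` — we
prove that the cell oscillation of the QUADRATIC slice `N_σ[f, f]` is bounded LINEARLY in the
oscillation size `S = ‖(I − Π₀) f‖_∞`:

  `‖(I − Π₀) N_σ[f, f]‖_∞ ≤ K · min(σ^{-1/2}, ‖L‖² σ^{-3/2}) · M · S`,  `K = 2 max(κ, 1)`.

Proof. Put `m = Π₀ f` and `w = f − m`. The cell mean `m` is invariant under EVERY translation
along `L` (the integrand `r ↦ f (x + rL)` is `1`-periodic, so `∫ₛ^{s+1} = ∫₀¹`: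
`Function.Periodic.intervalIntegral_add_eq` after `intervalIntegral.integral_comp_add_right`),
continuous (a parametric interval integral of a continuous integrand) and bounded by `M`; `w` is
continuous, `L`-periodic and bounded by `S`. By translation invariance of the slice operator
(`oseenSlice_eq_integral_sub`) the slice `N_σ[m, m]` is invariant under translations along `L`,
so `(I − Π₀) N_σ[m, m] = 0`. By bilinearity (`oseenSlice_add_left/right`, integrability of the
slice integrands from `integrable_oseenKernel_slice_of_bound`)
`N[f, f] = N[w, f] + N[m, w] + N[m, m]` pointwise, hence
`(I − Π₀) N[f, f] = (I − Π₀) N[w, f] + (I − Π₀) N[m, w]` (the interval integrals split because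
the slices are smooth, `contDiff_oseenSlice`), and the gap hypothesis for the pairs `(w, f)`
(bounds `S, M`) and `(m, w)` (bounds `M, S`) gives `2κ · min(…) · M · S ≤ K · min(…) · M · S`.

Tree lemmas: `Literature/Analysis/FluidPDE/OseenSlice.lean` (all proved). References: the
slice operator is that of Koch–Nadirashvili–Seregin–Šverák, Acta Math. 203 (2009), §3–§4; the
statement itself is elementary (folklore).
-/

noncomputable section

-- the summit and its single sub-problem share the name (CONVENTIONS §1), as in every Theorems file
set_option linter.dupNamespace false

open Set MeasureTheory Function Filter
open Literature.Analysis.FluidPDE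
open Literature.Analysis.UnboundedOperators (heatExtension)
open scoped RealInnerProductSpace Topology

namespace Summit.NavierStokesRegularity.NavierStokesRegularity.Theorems

local notation "E3" => EuclideanSpace ℝ (Fin 3)

/-- The cell mean `Π₀ f (x) = ∫₀¹ f (x + rL) dr` of an `L`-periodic field is invariant under
every translation along `L`: `Π₀ f (x + sL) = Π₀ f (x)` (the integrand is `1`-periodic in `r`).
[folklore] -/
theorem cellOscSlice_mean_transl {f : E3 → E3} {L : E3} (hper : ∀ x, f (x + L) = f x)
    (x : E3) (s : ℝ) :
    ∫ r in (0:ℝ)..1, f (x + s • L + r • L) = ∫ r in (0:ℝ)..1, f (x + r • L) := by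
  have hφ : Periodic (fun r : ℝ => f (x + r • L)) 1 := fun r => by
    simp only [add_smul, one_smul, ← add_assoc]
    exact hper _
  calc ∫ r in (0:ℝ)..1, f (x + s • L + r • L)
      = ∫ r in (0:ℝ)..1, (fun r' : ℝ => f (x + r' • L)) (r + s) := by
        refine intervalIntegral.integral_congr fun r _ => ?_
        simp only [add_smul]
        congr 1
        abel
    _ = ∫ r in (0:ℝ) + s..1 + s, (fun r' : ℝ => f (x + r' • L)) r :=
        intervalIntegral.integral_comp_add_right (fun r' : ℝ => f (x + r' • L)) s
    _ = ∫ r in s..s + 1, (fun r' : ℝ => f (x + r' • L)) r := by rw [zero_add, add_comm]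
    _ = ∫ r in (0:ℝ)..0 + 1, (fun r' : ℝ => f (x + r' • L)) r := hφ.intervalIntegral_add_eq s 0
    _ = ∫ r in (0:ℝ)..1, f (x + r • L) := by rw [zero_add]

/-- The cell mean of a continuous field is continuous (a parametric interval integral of the
continuous integrand `(x, r) ↦ f (x + rL)`). [folklore] -/
theorem cellOscSlice_mean_continuous {f : E3 → E3} (hf : Continuous f) (L : E3) :
    Continuous fun x : E3 => ∫ r in (0:ℝ)..1, f (x + r • L) := by
  have hunc : Continuous (Function.uncurry fun (x : E3) (r : ℝ) => f (x + r • L)) := by fun_prop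
  exact intervalIntegral.continuous_parametric_intervalIntegral_of_continuous' hunc 0 1

/-- The cell mean of a field bounded by `M` is bounded by `M`. [folklore] -/
theorem cellOscSlice_mean_norm_le {f : E3 → E3} {L : E3} {M : ℝ} (hM : ∀ x, ‖f x‖ ≤ M)
    (x : E3) : ‖∫ r in (0:ℝ)..1, f (x + r • L)‖ ≤ M := by
  have h := intervalIntegral.norm_integral_le_of_norm_le_const (a := (0:ℝ)) (b := 1)
    (f := fun r : ℝ => f (x + r • L)) (C := M) fun r _ => hM _
  simpa using h

/-- A slice `N_σ[a, b]` of two fields invariant under the translation by `v` is invariant under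
the translation by `v` (translation invariance of the slice operator). [folklore] -/
theorem cellOscSlice_oseenSlice_transl {σ : ℝ} {a b : E3 → E3} {v : E3}
    (ha : ∀ y, a (y + v) = a y) (hb : ∀ y, b (y + v) = b y) (x : E3) :
    oseenSlice σ a b (x + v) = oseenSlice σ a b x := by
  rw [oseenSlice_eq_integral_sub, oseenSlice_eq_integral_sub]
  refine integral_congr_ae (Eventually.of_forall fun z => ?_)
  simp only
  rw [add_sub_right_comm, ha, hb]

/-- **Stub 4 (the mean cannot force the oscillation).** Given the Oseen cell gap with constant
`κ`, the cell oscillation of the quadratic slice `N_σ[f, f]` of an `L`-periodic bounded continuous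
`f` is bounded LINEARLY in the oscillation `S = ‖(I − Π₀)f‖_∞`:
`≤ K · min(σ^{-1/2}, ‖L‖²σ^{-3/2}) · M · S` (`N[f,f] − N[m,m] = N[f−m, f] + N[m, f−m]` with
`m = Π₀f` invariant under all translations along `L`, so `(I − Π₀)N[m,m] = 0`). [folklore] -/
theorem stub_cellOscSlice :
    ∀ κ : ℝ,
      (∀ (L : E3) (f g : E3 → E3) (Mf Mg σ : ℝ), Continuous f → Continuous g →
        (∀ x, f (x + L) = f x) → (∀ x, g (x + L) = g x) → (∀ x, ‖f x‖ ≤ Mf) →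
        (∀ x, ‖g x‖ ≤ Mg) → 0 < σ → ∀ x : E3,
          ‖oseenSlice σ f g x - ∫ r in (0:ℝ)..1, oseenSlice σ f g (x + r • L)‖ ≤
            κ * min (σ ^ (-(1 / 2 : ℝ))) (‖L‖ ^ 2 * σ ^ (-(3 / 2 : ℝ))) * Mf * Mg) →
      ∃ K : ℝ, 0 < K ∧ ∀ (L : E3) (f : E3 → E3) (M S σ : ℝ), Continuous f →
        (∀ x, f (x + L) = f x) → (∀ x, ‖f x‖ ≤ M) →
        (∀ x, ‖f x - ∫ r in (0:ℝ)..1, f (x + r • L)‖ ≤ S) → 0 < σ → ∀ x : E3,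
          ‖oseenSlice σ f f x - ∫ r in (0:ℝ)..1, oseenSlice σ f f (x + r • L)‖ ≤
            K * min (σ ^ (-(1 / 2 : ℝ))) (‖L‖ ^ 2 * σ ^ (-(3 / 2 : ℝ))) * M * S := by
  intro κ hgap
  refine ⟨2 * max κ 1, by positivity, ?_⟩
  intro L f M S σ hf hper hM hS hσ x
  -- the cell mean `m = Π₀ f`: invariant along `L`, continuous, bounded by `M`
  obtain ⟨m, hm⟩ : ∃ m : E3 → E3, m = fun y => ∫ r in (0:ℝ)..1, f (y + r • L) := ⟨_, rfl⟩
  have hmt : ∀ (y : E3) (s : ℝ), m (y + s • L) = m y := fun y s => by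
    rw [hm]
    exact cellOscSlice_mean_transl hper y s
  have hmper : ∀ y, m (y + L) = m y := fun y => by simpa using hmt y 1
  have hmc : Continuous m := hm ▸ cellOscSlice_mean_continuous hf L
  have hmM : ∀ y, ‖m y‖ ≤ M := fun y => by
    rw [hm]
    exact cellOscSlice_mean_norm_le hM y
  -- the oscillation `w = f - m`: continuous, `L`-periodic, bounded by `S`
  obtain ⟨w, hw⟩ : ∃ w : E3 → E3, w = f - m := ⟨_, rfl⟩
  have hwc : Continuous w := hw ▸ hf.sub hmc
  have hwper : ∀ y, w (y + L) = w y := fun y => by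
    simp only [hw, Pi.sub_apply, hper, hmper]
  have hwS : ∀ y, ‖w y‖ ≤ S := fun y => by
    simp only [hw, Pi.sub_apply, hm]
    exact hS y
  have hfw : f = w + m := by rw [hw, sub_add_cancel]
  -- measurability of the three fields
  have hfa : AEStronglyMeasurable f volume := hf.aestronglyMeasurable
  have hma : AEStronglyMeasurable m volume := hmc.aestronglyMeasurable
  have hwa : AEStronglyMeasurable w volume := hwc.aestronglyMeasurable
  -- bilinearity: `N[f,f] = N[w,f] + N[m,w] + N[m,m]` pointwise
  have hdec : ∀ y, oseenSlice σ f f y =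
      oseenSlice σ w f y + oseenSlice σ m w y + oseenSlice σ m m y := by
    intro y
    have h1 : oseenSlice σ (w + m) f y = oseenSlice σ w f y + oseenSlice σ m f y :=
      oseenSlice_add_left (integrable_oseenKernel_slice_of_bound hσ hwa hfa hwS hM y)
        (integrable_oseenKernel_slice_of_bound hσ hma hfa hmM hM y)
    have h2 : oseenSlice σ m (w + m) y = oseenSlice σ m w y + oseenSlice σ m m y :=
      oseenSlice_add_right (integrable_oseenKernel_slice_of_bound hσ hma hwa hmM hwS y)
        (integrable_oseenKernel_slice_of_bound hσ hma hma hmM hmM y)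
    rw [← hfw] at h1 h2
    rw [h1, h2, add_assoc]
  -- `N[m,m]` is invariant under translations along `L`
  have hmmt : ∀ s : ℝ, oseenSlice σ m m (x + s • L) = oseenSlice σ m m x := fun s =>
    cellOscSlice_oseenSlice_transl (fun y => hmt y s) (fun y => hmt y s) x
  -- interval integrability of the two remaining cell averages (the slices are smooth)
  have hγ : Continuous fun r : ℝ => x + r • L := continuous_const.add (continuous_id.smul
    continuous_const)
  have hIwf : IntervalIntegrable (fun r : ℝ => oseenSlice σ w f (x + r • L)) volume 0 1 :=
    ((contDiff_oseenSlice (n := 0) hσ hwc.measurable hf.measurable hwS hM).continuous.comp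
      hγ).intervalIntegrable _ _
  have hImw : IntervalIntegrable (fun r : ℝ => oseenSlice σ m w (x + r • L)) volume 0 1 :=
    ((contDiff_oseenSlice (n := 0) hσ hmc.measurable hwc.measurable hmM hwS).continuous.comp
      hγ).intervalIntegrable _ _
  have hI : ∫ r in (0:ℝ)..1, oseenSlice σ f f (x + r • L) =
      ((∫ r in (0:ℝ)..1, oseenSlice σ w f (x + r • L)) +
        ∫ r in (0:ℝ)..1, oseenSlice σ m w (x + r • L)) + oseenSlice σ m m x := by
    have h1 : (fun r : ℝ => oseenSlice σ f f (x + r • L)) = fun r =>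
        (oseenSlice σ w f (x + r • L) + oseenSlice σ m w (x + r • L)) + oseenSlice σ m m x := by
      funext r
      rw [hdec, hmmt]
    rw [h1, intervalIntegral.integral_add (hIwf.add hImw) intervalIntegrable_const,
      intervalIntegral.integral_add hIwf hImw, intervalIntegral.integral_const, sub_zero, one_smul]
  -- the gap hypothesis for the pairs `(w, f)` and `(m, w)`
  have hA := hgap L w f S M σ hwc hf hwper hper hwS hM hσ x
  have hB := hgap L m w M S σ hmc hwc hmper hwper hmM hwS hσ x
  have hP : 0 ≤ min (σ ^ (-(1 / 2 : ℝ))) (‖L‖ ^ 2 * σ ^ (-(3 / 2 : ℝ))) :=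
    le_min (Real.rpow_nonneg hσ.le _) (mul_nonneg (sq_nonneg _) (Real.rpow_nonneg hσ.le _))
  have hM0 : 0 ≤ M := (norm_nonneg _).trans (hM x)
  have hS0 : 0 ≤ S := (norm_nonneg _).trans (hwS x)
  have hPMS : 0 ≤ min (σ ^ (-(1 / 2 : ℝ))) (‖L‖ ^ 2 * σ ^ (-(3 / 2 : ℝ))) * M * S :=
    mul_nonneg (mul_nonneg hP hM0) hS0
  rw [hdec x, hI]
  have e : oseenSlice σ w f x + oseenSlice σ m w x + oseenSlice σ m m x -
      ((∫ r in (0:ℝ)..1, oseenSlice σ w f (x + r • L)) +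
        (∫ r in (0:ℝ)..1, oseenSlice σ m w (x + r • L)) + oseenSlice σ m m x) =
      (oseenSlice σ w f x - ∫ r in (0:ℝ)..1, oseenSlice σ w f (x + r • L)) +
        (oseenSlice σ m w x - ∫ r in (0:ℝ)..1, oseenSlice σ m w (x + r • L)) := by
    abel
  rw [e]
  calc ‖(oseenSlice σ w f x - ∫ r in (0:ℝ)..1, oseenSlice σ w f (x + r • L)) +
        (oseenSlice σ m w x - ∫ r in (0:ℝ)..1, oseenSlice σ m w (x + r • L))‖
      ≤ ‖oseenSlice σ w f x - ∫ r in (0:ℝ)..1, oseenSlice σ w f (x + r • L)‖ +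
          ‖oseenSlice σ m w x - ∫ r in (0:ℝ)..1, oseenSlice σ m w (x + r • L)‖ :=
        norm_add_le _ _
    _ ≤ κ * min (σ ^ (-(1 / 2 : ℝ))) (‖L‖ ^ 2 * σ ^ (-(3 / 2 : ℝ))) * S * M +
          κ * min (σ ^ (-(1 / 2 : ℝ))) (‖L‖ ^ 2 * σ ^ (-(3 / 2 : ℝ))) * M * S := add_le_add hA hB
    _ = 2 * κ * (min (σ ^ (-(1 / 2 : ℝ))) (‖L‖ ^ 2 * σ ^ (-(3 / 2 : ℝ))) * M * S) := by ring
    _ ≤ 2 * max κ 1 * (min (σ ^ (-(1 / 2 : ℝ))) (‖L‖ ^ 2 * σ ^ (-(3 / 2 : ℝ))) * M * S) :=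
        mul_le_mul_of_nonneg_right (mul_le_mul_of_nonneg_left (le_max_left κ 1) zero_le_two) hPMS
    _ = 2 * max κ 1 * min (σ ^ (-(1 / 2 : ℝ))) (‖L‖ ^ 2 * σ ^ (-(3 / 2 : ℝ))) * M * S := by ring

end Summit.NavierStokesRegularity.NavierStokesRegularity.Theorems

end
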